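import Literature.NumberTheory.GelbartRogawski1991.LocalUnitaryUndoubling
import Literature.NumberTheory.Automorphic.LocalSchwartzBruhatBoxScalarFunctional
import HarnessLib

/-!
# The doubling principle at one finite place, GROUP LEVEL: an `N`-invariant eigenfunctional of the doubled Weil representation
# reads off the scalar by which an element acts on the `N`-coinvariants of the undoubled one

Topic `NumberTheory/GelbartRogawski1991`; namespace `Literature.NumberTheory.GelbartRogawski1991.UnitaryDualPair.LocalSplitting` (that of
★ `LocalUnitaryUndoubling`).  KERNEL MATHEMATICS ONLY (theorems; no definition, no named fact, no instance, no notation, no `sorry`).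
Cell `hodgecm-mathlib` (D-0151), programme P2, N3 road note v2 (`F0/P2/B-p18/g28/N3-ROAD.v2.B-p18g28.md` §2 «STATUS AT SEAT CLOSE»), brick
(D3d) THE ASSEMBLER — its GROUP-LEVEL CORE (lead B-p18 (g28) «=» 2026-08-31T20:54:22Z on the group-level reshape; seat A-p16 (g24)).

SETTING (★ `LocalUnitaryUndoubling` §3 verbatim): `F ⊂ E` CM-type quadratic data `(c, δ, d)`, a finite place `v` of `F`, a symmetric invertible
`T₀ ∈ M_n(F)`, `J = T₀ ⊗ 1`, the doubled `J^𝔻 = (T₀ ⊕ −T₀) ⊗ 1`, a homomorphism `s : U(J^𝔻)(F_v) →* S̃p(𝕎^𝔻_v)` over `ι^𝔻_v` (`hs`) — e.g. the CM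
datum's `localSplittingDatumCM … .localSplitting` — its undoubling ★ `undoubleLoc s : U(J)(F_v) →* S̃p(𝕎_v)`, and the undoubling identity ★
`toRep_undoubleLoc_boxSB`: `ω^𝔻(s(g ⊕ 1))(f₁ ⊠ f₂) = ω(undoubleLoc s g) f₁ ⊠ f₂`.  DATA: a group `G` read in `U(J)(F_v)` through `ch : G →* U(J)(F_v)`
(the road's `localLineInl ∘ localPiEquiv⁻¹ ∘ cmDatumLocalCongr T` on `U(Φ₃)(L⁺_v)`), a subgroup `N ≤ G` (the unipotent radical of the line's parabolic),
the pulled-back Weil representation `ω := toRep ∘ undoubleLoc s ∘ ch` on `𝒮(F_v^n)` and `K := Coinvariants.ker (ω|_N)`; a linear functional `lam` on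
`𝒮(F_v^{n+n})` (the road's `λ′ = ev₀ ∘ ω^𝔻(m₀ · s w₀)`).

* §1 `apply_boxSB_eq_zero_of_mem_coinvariantsKer` — if `lam` is INVARIANT under `ω^𝔻(s(ch n ⊕ 1))` for `n ∈ N` (the `P_{Δ′}`-eigen-law with
  eigenvalue `1`), then `lam (u ⊠ f₂) = 0` for every `u ∈ K` (generators `ω(n) f − f` and ★ `toRep_undoubleLoc_boxSB`; `⊠ f₂` is linear).
* §2 **`quotientScalar_eq_of_undoubling_eigenfunctional`** — if moreover `lam ≠ 0`, `lam ∘ ω^𝔻(s(ch t ⊕ 1)) = e · lam` (the eigen-law at `t`) and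
  `ω(t) f − c • f ∈ K` for all `f` (Schur: `t` acts on `r_N(ω) = 𝒮 ⧸ K` by `c`; the road's (β) ★ `F0P2oYCoinvariantsTorusScalarCM`), THEN `e = c`
  (★ p834000 `eq_of_apply_boxSB_eq_mul_of_ne_zero` at `U := K`, on a product with `lam ≠ 0` from ★ `exists_apply_boxSB_ne_zero`).  Corollary
  `sub_smul_mem_coinvariantsKer_of_undoubling_eigenfunctional`: `ω(t) f − e • f ∈ K` for all `f` — the eigenvalue of the doubled functional IS the
  quotient scalar («ker-level» output currency of the road, B-p18 (g28) 20:57:52Z).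
No Heisenberg-level Lagrangian bookkeeping is used (F0P3a-p03 (g8) 20:56:05Z: raw lifts pick up `−½β`; the group-level route avoids the lift).
[Kudla1994, §2–§3 (doubling); MoeglinVignerasWaldspurger1987, Chap. 2 II.1 Rem. (6), Chap. 3 §IV.5; GelbartRogawski1991, §3.1 Prop. 3.1.1, §3.2 (3.2.2) p. 457.]
HC_CM is proved only modulo the printed citations until rung 0 closes; count-neutral helper.

## References
* [GelbartRogawski1991] S. Gelbart, J. Rogawski, Invent. Math. 105 (1991), §3.1 Prop. 3.1.1 p. 455; §3.2 (3.2.2) p. 457.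
* [Kudla1994] S. Kudla, Israel J. Math. 87 (1994), §2, §3 Thm. 3.1.
* [MoeglinVignerasWaldspurger1987] LNM 1291 (1987), Chap. 2 II.1 Rem. (6); Chap. 3 §IV.5.
* [BernsteinZelevinsky1976] I. N. Bernstein, A. V. Zelevinsky, Russian Math. Surveys 31 (1976), §2.30–2.33 (coinvariants).
-/

set_option autoImplicit false

noncomputable section

open NumberField IsDedekindDomain Matrix
open Literature.RepresentationTheory.HeisenbergGroup
open Literature.NumberTheory.Automorphic Literature.NumberTheory.Weil1964

namespace Literature.NumberTheory.GelbartRogawski1991.UnitaryDualPair.LocalSplitting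

variable (F : Type) [Field F] [NumberField F] (E : Type) [Field E] [NumberField E] [Algebra F E] (c : E ≃ₐ[F] E)
  (v : HeightOneSpectrum (𝓞 F)) (n : ℕ) {T₀ : Matrix (Fin n) (Fin n) F}
  {J : Matrix (Fin n) (Fin n) E} (hJ : J = T₀.map (algebraMap F E))
  {JD : Matrix (Fin (n + n)) (Fin (n + n)) E} (hJD : JD = (gramD F n T₀).map (algebraMap F E))
  [Algebra.IsQuadraticExtension F E] {δ : E} (hcδ : c δ = -δ) (hδ : δ ≠ 0) {d : F} (hd : δ * δ = algebraMap F E d)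
  (hT₀ : T₀.IsSymm) (hT₀d : IsUnit T₀.det)
  (s : UnitaryGroup.localPi E c (n + n) JD v →* LocalMp F (n + n) (gramD F n T₀) v)
  (hs : ∀ g, MpPsi.proj _ (s g) = iota F E c (n + n) hcδ hδ hd (gramD F n T₀) (gramD_isSymm F n hT₀) hJD v g)
  {G : Type*} [Group G] (ch : G →* UnitaryGroup.localPi E c n J v) (N : Subgroup G)
  (lam : SchwartzBruhat (Fin (n + n) → v.adicCompletion F) →ₗ[ℂ] ℂ)

/-! ## §1 An `N`-invariant functional of the doubled representation kills `K ⊠ 𝒮` -/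

/-- **the generators**: if `lam` is invariant under `ω^𝔻(s(ch nn ⊕ 1))` then `lam ((ω(nn) f − f) ⊠ f₂) = 0`, `ω = toRep ∘ undoubleLoc s ∘ ch`
(★ `toRep_undoubleLoc_boxSB`). [cite: MoeglinVignerasWaldspurger1987, Chap. 2 II.1 Rem. (6)] [cite: GelbartRogawski1991, §3.1 Prop. 3.1.1 p. 455 L1–3] -/
theorem apply_boxSB_sub_eq_zero_of_invariant (nn : G)
    (hinv : ∀ Φ : SchwartzBruhat (Fin (n + n) → v.adicCompletion F),
      lam (MpPsi.toRep (localSchrodinger F (n + n) (gramD F n T₀) v) (s (inlLoc F E c v n hJ hJD (ch nn))) Φ) = lam Φ)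
    (f f₂ : SchwartzBruhat (Fin n → v.adicCompletion F)) :
    lam (boxSB (v.adicCompletion F) (e₂ n)
      (MpPsi.toRep (localSchrodinger F n T₀ v) (undoubleLoc F E c v n hJ hJD hcδ hδ hd hT₀ hT₀d s hs (ch nn)) f - f) f₂) = 0 := by
  rw [← sumEquivSB_tmul, TensorProduct.sub_tmul, map_sub, sumEquivSB_tmul, sumEquivSB_tmul, map_sub,
    ← toRep_undoubleLoc_boxSB F E c v n hJ hJD hcδ hδ hd hT₀ hT₀d s hs (ch nn) f f₂, hinv, sub_self]

/-- **`lam (u ⊠ f₂) = 0` for every `u ∈ K = Coinvariants.ker (ω|_N)`** when `lam` is invariant under `ω^𝔻(s(ch n ⊕ 1))`, `n ∈ N`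
(span of the generators; `⊠ f₂` is linear in the first slot). [cite: BernsteinZelevinsky1976, §2.30–2.33] [cite: MoeglinVignerasWaldspurger1987, Chap. 3 §IV.5] -/
theorem apply_boxSB_eq_zero_of_mem_coinvariantsKer
    (hinv : ∀ nn ∈ N, ∀ Φ : SchwartzBruhat (Fin (n + n) → v.adicCompletion F),
      lam (MpPsi.toRep (localSchrodinger F (n + n) (gramD F n T₀) v) (s (inlLoc F E c v n hJ hJD (ch nn))) Φ) = lam Φ)
    {u : SchwartzBruhat (Fin n → v.adicCompletion F)}
    (hu : u ∈ Representation.Coinvariants.ker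
      ((((MpPsi.toRep (localSchrodinger F n T₀ v)).comp (undoubleLoc F E c v n hJ hJD hcδ hδ hd hT₀ hT₀d s hs)).comp ch).comp N.subtype))
    (f₂ : SchwartzBruhat (Fin n → v.adicCompletion F)) :
    lam (boxSB (v.adicCompletion F) (e₂ n) u f₂) = 0 := by
  -- `u ↦ lam (u ⊠ f₂)` is linear; it kills the generators `ω(nn) f − f`, hence their span `K`
  have hle : Representation.Coinvariants.ker
      ((((MpPsi.toRep (localSchrodinger F n T₀ v)).comp (undoubleLoc F E c v n hJ hJD hcδ hδ hd hT₀ hT₀d s hs)).comp ch).comp N.subtype) ≤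
      LinearMap.ker (lam ∘ₗ (sumEquivSB (v.adicCompletion F) (e₂ n)).toLinearMap ∘ₗ
        (TensorProduct.mk ℂ (SchwartzBruhat (Fin n → v.adicCompletion F)) (SchwartzBruhat (Fin n → v.adicCompletion F))).flip f₂) := by
    refine Submodule.span_le.2 ?_
    rintro _ ⟨⟨nn, f⟩, rfl⟩
    rw [SetLike.mem_coe, LinearMap.mem_ker]
    simp only [LinearMap.coe_comp, Function.comp_apply, LinearEquiv.coe_coe, LinearMap.flip_apply, TensorProduct.mk_apply,
      sumEquivSB_tmul, MonoidHom.coe_comp, Subgroup.coe_subtype]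
    exact apply_boxSB_sub_eq_zero_of_invariant F E c v n hJ hJD hcδ hδ hd hT₀ hT₀d s hs ch lam (nn : G) (hinv nn nn.2) f f₂
  have h := hle hu
  rw [LinearMap.mem_ker] at h
  simpa only [LinearMap.coe_comp, Function.comp_apply, LinearEquiv.coe_coe, LinearMap.flip_apply, TensorProduct.mk_apply,
    sumEquivSB_tmul] using h

/-! ## §2 The eigenvalue of the doubled functional is the quotient scalar -/

/-- **THE DOUBLING PRINCIPLE, GROUP LEVEL.**  Let `lam ≠ 0` be invariant under `ω^𝔻(s(ch n ⊕ 1))` for `n ∈ N` and satisfy the eigen-law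
`lam (ω^𝔻(s(ch t ⊕ 1)) Φ) = e · lam Φ`; suppose `t` acts on `r_N(ω) = 𝒮(F_v^n) ⧸ K` by the scalar `c` (`ω(t) f − c • f ∈ K`).  Then `e = c`.
(★ p834000 `eq_of_apply_boxSB_eq_mul_of_ne_zero` at `U := K`; the undoubling identity ★ `toRep_undoubleLoc_boxSB` turns the eigen-law into
`lam ((ω(t) f₁) ⊠ f₂) = e · lam (f₁ ⊠ f₂)`.)  Road use: `e = μ_w(α)|α|_w^{1/2}` (parabolic normalisation at `w₀ (m(α) ⊕ 1) w₀ ∈ P_Δ`), `c = c(α)` (Schur).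
[cite: Kudla1994, §3 Thm. 3.1] [cite: MoeglinVignerasWaldspurger1987, Chap. 3 §IV.5] [cite: GelbartRogawski1991, §3.2 (3.2.2) p. 457] -/
theorem quotientScalar_eq_of_undoubling_eigenfunctional (hne : lam ≠ 0)
    (hinv : ∀ nn ∈ N, ∀ Φ : SchwartzBruhat (Fin (n + n) → v.adicCompletion F),
      lam (MpPsi.toRep (localSchrodinger F (n + n) (gramD F n T₀) v) (s (inlLoc F E c v n hJ hJD (ch nn))) Φ) = lam Φ)
    (t : G) (e : ℂ)
    (heig : ∀ Φ : SchwartzBruhat (Fin (n + n) → v.adicCompletion F),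
      lam (MpPsi.toRep (localSchrodinger F (n + n) (gramD F n T₀) v) (s (inlLoc F E c v n hJ hJD (ch t))) Φ) = e * lam Φ)
    (c' : ℂ)
    (hc : ∀ f : SchwartzBruhat (Fin n → v.adicCompletion F),
      MpPsi.toRep (localSchrodinger F n T₀ v) (undoubleLoc F E c v n hJ hJD hcδ hδ hd hT₀ hT₀d s hs (ch t)) f - c' • f ∈
        Representation.Coinvariants.ker
          ((((MpPsi.toRep (localSchrodinger F n T₀ v)).comp (undoubleLoc F E c v n hJ hJD hcδ hδ hd hT₀ hT₀d s hs)).comp ch).comp N.subtype)) :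
    e = c' := by
  obtain ⟨f₁, f₂, hf⟩ := exists_apply_boxSB_ne_zero (v.adicCompletion F) (e₂ n) lam hne
  refine eq_of_apply_boxSB_eq_mul_of_ne_zero (v.adicCompletion F) (e₂ n) lam _
    (fun u hu f₂' => apply_boxSB_eq_zero_of_mem_coinvariantsKer F E c v n hJ hJD hcδ hδ hd hT₀ hT₀d s hs ch N lam hinv hu f₂')
    (MpPsi.toRep (localSchrodinger F n T₀ v) (undoubleLoc F E c v n hJ hJD hcδ hδ hd hT₀ hT₀d s hs (ch t))) c' e hc f₁ f₂ ?_ hf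
  rw [← toRep_undoubleLoc_boxSB F E c v n hJ hJD hcδ hδ hd hT₀ hT₀d s hs (ch t) f₁ f₂, heig]

/-- **«KER-LEVEL» OUTPUT**: under the same hypotheses, `ω(t) f − e • f ∈ K` for every `f` — the eigenvalue `e` of the doubled functional IS the scalar
by which `t` acts on `r_N(ω)`. [cite: Kudla1994, §3 Thm. 3.1] [cite: GelbartRogawski1991, §3.2 (3.2.2) p. 457] -/
theorem sub_smul_mem_coinvariantsKer_of_undoubling_eigenfunctional (hne : lam ≠ 0)
    (hinv : ∀ nn ∈ N, ∀ Φ : SchwartzBruhat (Fin (n + n) → v.adicCompletion F),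
      lam (MpPsi.toRep (localSchrodinger F (n + n) (gramD F n T₀) v) (s (inlLoc F E c v n hJ hJD (ch nn))) Φ) = lam Φ)
    (t : G) (e : ℂ)
    (heig : ∀ Φ : SchwartzBruhat (Fin (n + n) → v.adicCompletion F),
      lam (MpPsi.toRep (localSchrodinger F (n + n) (gramD F n T₀) v) (s (inlLoc F E c v n hJ hJD (ch t))) Φ) = e * lam Φ)
    (hSchur : ∃ c' : ℂ, ∀ f : SchwartzBruhat (Fin n → v.adicCompletion F),
      MpPsi.toRep (localSchrodinger F n T₀ v) (undoubleLoc F E c v n hJ hJD hcδ hδ hd hT₀ hT₀d s hs (ch t)) f - c' • f ∈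
        Representation.Coinvariants.ker
          ((((MpPsi.toRep (localSchrodinger F n T₀ v)).comp (undoubleLoc F E c v n hJ hJD hcδ hδ hd hT₀ hT₀d s hs)).comp ch).comp N.subtype))
    (f : SchwartzBruhat (Fin n → v.adicCompletion F)) :
    MpPsi.toRep (localSchrodinger F n T₀ v) (undoubleLoc F E c v n hJ hJD hcδ hδ hd hT₀ hT₀d s hs (ch t)) f - e • f ∈
      Representation.Coinvariants.ker
        ((((MpPsi.toRep (localSchrodinger F n T₀ v)).comp (undoubleLoc F E c v n hJ hJD hcδ hδ hd hT₀ hT₀d s hs)).comp ch).comp N.subtype) := by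
  obtain ⟨c', hc⟩ := hSchur
  rw [quotientScalar_eq_of_undoubling_eigenfunctional F E c v n hJ hJD hcδ hδ hd hT₀ hT₀d s hs ch N lam hne hinv t e heig c' hc]
  exact hc f

end Literature.NumberTheory.GelbartRogawski1991.UnitaryDualPair.LocalSplitting

end
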